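import Summits.QuantumFields.YangMills.Theorems.BalabanUVNodesN15KingModelTheorem21Rescaling
import Summits.QuantumFields.YangMills.Theorems.BalabanUVNodesN15KingModelTheorem21NE2Unit

/-!
# BalabanUVNodes ∕ N15 — THE KING-MODEL RUNG (PART Ϝ, package): KING's THEOREM 2.1 FOR THE FREE FIELD IN ONE CONJUNCTION, AND THE (2.15) BRIDGE AS A CONVOLUTION —
# `Z′(T, K) = Z^{ε_K}(T_{ε_K}, J∘blk) · 𝔼 e^{⟨J, ξ⟩}`, `ξ ~ N(0, a_K⁻¹·1)` the block-spin white noise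
# (Track A, DAG node N15 = NE2; FAN-OUT v1.1 §N15 s3 «KING-MODEL RUNG … NE2's analogue DECIDED in the model»)

HONEST FRAMING.  Count-neutral (cell `pub-ymgap`, seat `pub-ymgap-dag-n15-e` g33; `--supports stmt-QuantumFields-27366 --as helper` = K3⁸
`SpineGivenEndpointR13SepCoPHV`).  TEMPLATE LITERATURE: C. King, *The U(1) Higgs model. I. The continuum limit*, Commun. Math. Phys. **102** (1986) 649–677
[King1986] — KING's OWN `A = 0`, `g = 0` MODEL (free massive lattice scalar field) on the tori (2.21) and on the King-model family.  Assembly of parts Ϝ-a…Ϝ-f BY NAME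
plus one identity: the white-noise factor of the (2.15) bridge IS the moment generating function of the Gaussian `N(0, a_K⁻¹·1)` that King's averaging kernel
`e^{−(a∕2)|ψ − Qφ|²}` ((2.4)–(2.6)) adds at each step (accumulated constant `a_K`, (2.13)).  NOT the U(1) Higgs model; NOT Bałaban's objects; NOT a node discharge
(N15 is booked through n15-a's knit, untouched here); nothing continuum-Yang–Mills ∕ ℝ⁴ ∕ OS ∕ mass-gap ∕ Clay.  0 `sorry`; standard axioms; 0 `def`.

WHAT THE CURVED CASE ADDS (one line, honest).  For the interacting U(1) Higgs model (and a fortiori for Bałaban's gauge theories) there is no Gaussian closed form: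
Theorem 2.1 is reached through Theorems 3.1∕3.4 (the tree's `RGData.hasContinuumLimit_of_thm31_thm34`), whose model-specific inputs (the effective actions (3.14) and
their bounds) are not constructed in the tree; what PART Ϝ decides is the `g = 0` skeleton of (2.22)–(2.23) with explicit limits, constants and rates.

WHAT THIS FILE PROVES (kernel).  §1 `inv_smul_one` (`(a·1)⁻¹ = a⁻¹·1`), ★ `mgf_whiteNoise` (`∫e^{⟨J,ξ⟩}ρ_{a·1}(ξ)dξ = e^{|J|²∕(2a)}`), ★★ **`kingBlockZ_eq_kingFreeZ_mul_mgf`**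
(the (2.15) bridge as a convolution identity: block-field MGF = fine functional at the block source × white-noise MGF).  §1b `inv_aK_eq_inv_mul`, `tendsto_inv_aK_atTop`,
★ **`tendsto_blockCov_atTop`** (the `δ`-function limit `a → ∞`: `(Δ^{(K)})⁻¹(b,b′) → S₂^{(K)}(b,b′)`).  §2 ★★★ **`king_thm21_freeField_package`**
(`Thm21Printed` for `kingFreeZ`, `kingBlockZ`, `kingFreeZlev`; the `ε_K²` rates; the (2.15) bridge; the rescaling identity (2.20)), ★★★ **`king_thm21_twoPoint_package`**
(the block-smeared Schwinger function: limit + (4.38) rate + `m⁻²` bound + decay + PSD on every unit torus; `NE2PlusUnit` and `N15At` on the King-model carriers).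

HONEST SCOPE.  As in parts Ϝ-a…Ϝ-f: free field, block-constant sources (one fixed `L`-adic scale), odd `L ≥ 3` de facto, `m² > 0`, `a > 0`.  N15 untouched; counts unmoved.
Locators: [King1986] (2.4)–(2.6) p.652, (2.13)–(2.15) p.653, (2.20)–(2.23) p.654, Lemma 4.5 (4.38) p.674.
-/

noncomputable section

open scoped BigOperators
open Finset Matrix Filter Topology MeasureTheory

namespace Summit.QuantumFields.YangMills.BalabanUVNodes.N15KingModelRung

open Literature.MathematicalPhysics.QuantumFieldTheory.Balaban1983to89.B5Prop11Plancherel (Tor fine chi sOf)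
open Literature.MathematicalPhysics.QuantumFieldTheory.Balaban1983to89.QGQInverse (Coercive)
open Literature.MathematicalPhysics.QuantumFieldTheory.Balaban1983to89.T4EtaRate (NE2PlusUnit)
open Literature.MathematicalPhysics.QuantumFieldTheory.King1986 (aK aK_pos)
open Literature.MathematicalPhysics.QuantumFieldTheory.King1986.Torus
open Literature.MathematicalPhysics.QuantumFieldTheory.King1986.ContinuumLimit (eps eps_pos Torus221 Thm21Printed)
open Summit.QuantumFields.YangMills.BalabanUVNodes.N15KingModelRung.FreeField (gaussNorm integral_exp_dot_gaussDensity coercive_scalar)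
open YMDAG.UVSplit (N15At)

variable {d : ℕ}

/-! ## §1 The white-noise factor of the (2.15) bridge is a Gaussian MGF -/

section WhiteNoise

variable {ι : Type*} [Fintype ι] [DecidableEq ι]

/-- `(a·1)⁻¹ = a⁻¹·1` (`a ≠ 0`). [folklore] -/
theorem inv_smul_one {a : ℝ} (ha : a ≠ 0) : (a • (1 : Matrix ι ι ℝ))⁻¹ = a⁻¹ • (1 : Matrix ι ι ℝ) := by
  refine Matrix.inv_eq_right_inv ?_
  rw [Matrix.smul_mul, Matrix.one_mul, smul_smul, mul_inv_cancel₀ ha, one_smul]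

/-- ★ **THE WHITE-NOISE MGF**: `∫ e^{⟨J,ξ⟩} e^{−(a∕2)|ξ|²}dξ ∕ 𝒩(a·1) = e^{|J|²∕(2a)}` (`a > 0`) — the Gaussian `N(0, a⁻¹·1)` that King's averaging kernel contributes.
[cite: King1986, (2.4)–(2.6) p.652, (2.13) p.653] -/
theorem mgf_whiteNoise {a : ℝ} (ha : 0 < a) (J : ι → ℝ) :
    ∫ ξ : ι → ℝ, Real.exp (J ⬝ᵥ ξ) * (Real.exp (-(1 / 2 : ℝ) * (ξ ⬝ᵥ ((a • (1 : Matrix ι ι ℝ)) *ᵥ ξ))) / gaussNorm (a • (1 : Matrix ι ι ℝ)))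
      = Real.exp ((J ⬝ᵥ J) / (2 * a)) := by
  have hsymm : (a • (1 : Matrix ι ι ℝ))ᵀ = a • (1 : Matrix ι ι ℝ) := by rw [Matrix.transpose_smul, Matrix.transpose_one]
  rw [integral_exp_dot_gaussDensity ha (coercive_scalar a) hsymm J, inv_smul_one ha.ne', Matrix.smul_mulVec, Matrix.one_mulVec, dotProduct_smul, smul_eq_mul]
  congr 1
  field_simp

variable (L : ℕ) [NeZero L] (a m2 : ℝ)

/-- ★★ **THE (2.15) BRIDGE AS A CONVOLUTION IDENTITY**: the block-field MGF is the fine-lattice functional at the block-constant source TIMES the white-noise MGF —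
`Z′(T, K) = Z^{ε_K}(T_{ε_K}, J_T∘blk) · ∫e^{⟨J_T,ξ⟩}ρ_{a_K·1}(ξ)dξ` (`K ≥ 1`): King's block field after `K` steps is, in law, the block average of the fine free field plus an
independent Gaussian noise of covariance `a_K⁻¹·1`. [cite: King1986, (2.13)–(2.15) p.653, (2.4)–(2.6) p.652] -/
theorem kingBlockZ_eq_kingFreeZ_mul_mgf (hL : 2 ≤ L) (ha : 0 < a) (hm : 0 < m2) (J : ∀ T : Torus221 (d + 1), Tor (t221Sites T) → ℝ) (T : Torus221 (d + 1))
    {K : ℕ} (hK : 1 ≤ K) :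
    haveI := t221Sites_neZero T
    kingBlockZ L a m2 J T K = kingFreeZ L m2 J T K
      * ∫ ξ : Tor (t221Sites T) → ℝ, Real.exp (J T ⬝ᵥ ξ)
          * (Real.exp (-(1 / 2 : ℝ) * (ξ ⬝ᵥ ((aK a L K • (1 : Matrix (Tor (t221Sites T)) (Tor (t221Sites T)) ℝ)) *ᵥ ξ)))
            / gaussNorm (aK a L K • (1 : Matrix (Tor (t221Sites T)) (Tor (t221Sites T)) ℝ))) := by
  haveI := t221Sites_neZero T
  have hL1 : (1 : ℝ) < L := by exact_mod_cast (show 1 < L by omega)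
  rw [mgf_whiteNoise (aK_pos ha hL1 hK), kingBlockZ_eq_kingFreeZ_mul L a m2 hL ha hm J T hK]

end WhiteNoise

/-! ## §1b The `δ`-function limit `a → ∞`: the block-field covariance tends to the Schwinger function -/

section DeltaLimit

variable (L : ℕ) [NeZero L]

omit [NeZero L] in
/-- `a_K⁻¹ = a⁻¹·(1 − L^{−2K})∕(1 − L⁻²)` — linear in `a⁻¹`. [cite: King1986, (2.13) p.653] -/
theorem inv_aK_eq_inv_mul (a : ℝ) (K : ℕ) :
    (aK a L K)⁻¹ = a⁻¹ * ((1 - ((L : ℝ) ^ (2 * K))⁻¹) / (1 - ((L : ℝ) ^ 2)⁻¹)) := by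
  rw [Literature.MathematicalPhysics.QuantumFieldTheory.King1986.inv_aK, mul_comm a, div_mul_eq_div_div, div_eq_inv_mul]

omit [NeZero L] in
/-- `a_K⁻¹ → 0` as `a → ∞` (every `K`, `L`). [cite: King1986, (2.13) p.653] -/
theorem tendsto_inv_aK_atTop (K : ℕ) : Tendsto (fun a : ℝ => (aK a L K)⁻¹) atTop (𝓝 0) := by
  have h := (tendsto_inv_atTop_zero).mul_const ((1 - ((L : ℝ) ^ (2 * K))⁻¹) / (1 - ((L : ℝ) ^ 2)⁻¹))
  rw [zero_mul] at h
  refine h.congr fun a => ?_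
  rw [inv_aK_eq_inv_mul]

omit [NeZero L] in
/-- ★ **THE `δ`-FUNCTION LIMIT**: as the averaging constant `a → ∞` (King's Gaussian kernel `e^{−(a∕2)|ψ−Qφ|²}` tends to the `δ`-function block spin), the block-field
covariance tends to the block-smeared Schwinger function: `(Δ^{(K)})⁻¹(b,b′) → S₂^{(K)}(b,b′)` (`N ≥ 1`, `m² > 0`; the noise `a_K⁻¹[b=b′]` vanishes).
[cite: King1986, (2.4)–(2.6) p.652, (2.13)–(2.14) p.653] -/
theorem tendsto_blockCov_atTop (N : ℕ) [NeZero N] (hN1 : 1 ≤ N) (M : Fin (d + 1) → ℕ) [∀ μ, NeZero (M μ)] {m2 : ℝ} (hm : 0 < m2) (K : ℕ) (hK : 1 ≤ K)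
    (hL : 2 ≤ L) (b b' : Tor M) :
    Tendsto (fun a : ℝ => blockCov L N M a m2 K b b') atTop (𝓝 (kingS2 N M m2 b b')) := by
  have hL1 : (1 : ℝ) < L := by exact_mod_cast (show 1 < L by omega)
  have hlim : Tendsto (fun a : ℝ => (aK a L K)⁻¹ * (if b = b' then (1 : ℝ) else 0) + kingS2 N M m2 b b') atTop (𝓝 (kingS2 N M m2 b b')) := by
    have h := ((tendsto_inv_aK_atTop L K).mul_const (if b = b' then (1 : ℝ) else 0)).add_const (kingS2 N M m2 b b')
    rwa [zero_mul, zero_add] at h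
  refine hlim.congr' ?_
  filter_upwards [eventually_gt_atTop 0] with a ha
  rw [blockCov, kingS2_eq_effLaplacian_inv_sub N M hN1 (aK_pos ha hL1 hK) hm b b']
  ring

end DeltaLimit

/-! ## §2 The packages -/

section Package

variable (L : ℕ) [NeZero L] (a m2 : ℝ)

/-- ★★★ **KING's THEOREM 2.1 FOR THE FREE FIELD — THE PACKAGE** (odd `L ≥ 2`, `a, m² > 0`, source bound `H`, any level `k₀`): (1) `Thm21Printed` for the fine-lattice
functionals at unit-block sources, (2) for the RG block-field functionals, (3) for sources constant on the `ε_{k₀}`-blocks; (4) the rate `|ln Z^{ε_K} − ln Z| ≤ ½C_S H²|T|ε_K²`;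
(5) the block-field rate; (6) the (2.15) bridge `Z′ = Z^{ε_K}·e^{|J|²∕(2a_K)}`; (7) King's rescaling (2.20) for `ln Z`. [cite: King1986, Thm 2.1 (2.22)–(2.23) p.654, (2.13)–(2.15) p.653, (2.20) p.654] -/
theorem king_thm21_freeField_package (hLodd : Odd L) (hL : 2 ≤ L) (ha : 0 < a) (hm : 0 < m2) (H : ℝ) (k₀ : ℕ) :
    (∀ J : ∀ T : Torus221 (d + 1), Tor (t221Sites T) → ℝ, (∀ T b, |J T b| ≤ H) → Thm21Printed (kingFreeZ L m2 J))
    ∧ (∀ J : ∀ T : Torus221 (d + 1), Tor (t221Sites T) → ℝ, (∀ T b, |J T b| ≤ H) → Thm21Printed (kingBlockZ L a m2 J))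
    ∧ (∀ J : ∀ T : Torus221 (d + 1), Tor (fine (L ^ k₀) (t221Sites T)) → ℝ, (∀ T b, |J T b| ≤ H) → Thm21Printed (kingFreeZlev L m2 k₀ J))
    ∧ (∀ J : ∀ T : Torus221 (d + 1), Tor (t221Sites T) → ℝ, (∀ T b, |J T b| ≤ H) → ∀ T : Torus221 (d + 1), ∀ K : ℕ, 1 ≤ K →
        |Real.log (kingFreeZ L m2 J T K) - Real.log (kingFreeZlim m2 J T)| ≤ symbolRateConst 1 L m2 * H ^ 2 / 2 * T.vol * eps L K ^ 2)
    ∧ (∀ J : ∀ T : Torus221 (d + 1), Tor (t221Sites T) → ℝ, (∀ T b, |J T b| ≤ H) → ∀ T : Torus221 (d + 1), ∀ K : ℕ, 1 ≤ K →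
        |Real.log (kingBlockZ L a m2 J T K) - Real.log (kingBlockZlim L a m2 J T)| ≤ (symbolRateConst a L m2 + (aInf a L)⁻¹) * H ^ 2 / 2 * T.vol * eps L K ^ 2)
    ∧ (∀ J : ∀ T : Torus221 (d + 1), Tor (t221Sites T) → ℝ, ∀ T : Torus221 (d + 1), ∀ K : ℕ, 1 ≤ K →
        haveI := t221Sites_neZero T
        kingBlockZ L a m2 J T K = kingFreeZ L m2 J T K * Real.exp ((J T ⬝ᵥ J T) / (2 * aK a L K)))
    ∧ (∀ (N₁ N₀ : ℕ) [NeZero N₁] [NeZero N₀] (M : Fin d → ℕ) [∀ μ, NeZero (M μ)] (h : Tor (fine (N₁ * N₀) M) → ℝ),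
        Real.log (kingFineZ (N₁ * N₀) M m2 h)
          = (((N₀ : ℝ) ^ (d + 2))⁻¹) * Real.log (kingFineZ N₁ (fine N₀ M) (m2 / (N₀ : ℝ) ^ 2) (h ∘ flatten N₁ N₀ M))) :=
  ⟨fun _ hJ => thm21Printed_kingFreeZ L m2 hLodd hL hm hJ,
    fun _ hJ => thm21Printed_kingBlockZ L a m2 hLodd hL ha hm hJ,
    fun _ hJ => thm21Printed_kingFreeZlev L m2 k₀ hLodd hL hm hJ,
    fun _ hJ T _ hK => abs_log_kingFreeZ_sub_log_lim_le L m2 hLodd hL hm hJ T hK,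
    fun _ hJ T _ hK => abs_log_kingBlockZ_sub_log_lim_le L a m2 hLodd hL ha hm hJ T hK,
    fun J T _ hK => kingBlockZ_eq_kingFreeZ_mul L a m2 hL ha hm J T hK,
    fun N₁ N₀ _ _ M _ h => log_kingFineZ_flatten N₁ N₀ M hm h⟩

/-- ★★★ **THE TWO-POINT PACKAGE** (odd `L ≥ 2`, `a, m² > 0`): on EVERY unit torus `M : Fin (d+1) → ℕ` and all `b, b′`: (1) `S₂^{(K)} → S₂^{(∞)}`; (2) the (4.38)-shape rate;
(3) `|S₂^{(∞)}| ≤ m⁻²`; (4) Thm 3.3 decay off the diagonal; (5) PSD of `S₂^{(∞)}`; and on the King-model carriers (6) `NE2PlusUnit` for the Schwinger pair (every `c35`),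
(7) `N15At` (`d + 1 = 4`, `0 < γ ≤ 1`). [cite: King1986, Thm 2.1 (2.22) p.654, Lemma 4.5 (4.38) p.674, Thm 3.3 (3.6) p.655] -/
theorem king_thm21_twoPoint_package (hLodd : Odd L) (hL : 2 ≤ L) (ha : 0 < a) (hm : 0 < m2) :
    haveI : NeZero L := inferInstance
    (∀ (M : Fin (d + 1) → ℕ) [∀ μ, NeZero (M μ)] (b b' : Tor M),
        Tendsto (fun K : ℕ => kingS2 (L ^ K) M m2 b b') atTop (𝓝 (kingS2Lim M m2 b b'))
        ∧ (∀ K : ℕ, 1 ≤ K → |kingS2 (L ^ K) M m2 b b' - kingS2Lim M m2 b b'|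
            ≤ (2 * CdiffM (d + 1) a m2 L + (aInf a L)⁻¹) * Real.exp (-(kapM (d + 1) a m2 L / 2 * tdistT M b b')) * ((L : ℝ) ^ K)⁻¹)
        ∧ |kingS2Lim M m2 b b'| ≤ m2⁻¹
        ∧ (b ≠ b' → |kingS2Lim M m2 b b'| ≤ 2 / gamM a m2 L * Real.exp (-(kapM (d + 1) a m2 L * tdistT M b b')))
        ∧ (∀ J : Tor M → ℝ, 0 ≤ ∑ c, ∑ c', J c * kingS2Lim M m2 c c' * J c'))
    ∧ (∀ c35 : ℝ, NE2PlusUnit c35 (kingVolInstance d L) (kingS2Unit L m2) (fun _ _ => True) (kingUnitDist L))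
    ∧ (∀ {γ : ℝ}, 0 < γ → γ ≤ 1 → ∀ c35 p : ℝ, N15At (kingVolCarriersSchwinger L a m2 c35 p)) := by
  have hNZ : (⟨by omega⟩ : NeZero L) = ‹NeZero L› := Subsingleton.elim _ _
  refine ⟨fun M _ b b' => ⟨?_, fun K hK => ?_, abs_kingS2Lim_le L M hLodd hL hm b b', fun hbb => abs_kingS2Lim_le_decay L M hLodd hL ha hm hbb,
      fun J => kingS2Lim_form_nonneg L M hLodd hL hm J⟩,
    fun c35 => ne2PlusUnit_kingS2 L hLodd hL ha hm c35, fun hγ0 hγ1 c35 p => n15At_kingModelRung_schwinger L hLodd hL ha hm hγ0 hγ1 c35 p⟩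
  · have h := tendsto_kingS2 L M hLodd hL hm b b'
    exact h
  · have h := abs_kingS2_sub_lim_le L M hLodd hL ha hm hK b b'
    exact h

end Package

end Summit.QuantumFields.YangMills.BalabanUVNodes.N15KingModelRung

end
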